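import Summits.BirchSwinnertonDyer.BirchSwinnertonDyer.Theses.SchneiderFreeAdditiveX3
import HarnessLib

/-!
# Route `SchneiderFreeAdditiveX3` (rung K1 door, cell `bsd-schneider-ideate`): the `Assembly` item PROVED

Item `stmt-BirchSwinnertonDyer-19182` of route `route-BirchSwinnertonDyer-SchneiderFreeAdditiveX3`
(`Theses/SchneiderFreeAdditiveX3.lean`, rev 3, assembly, rank 1):
`PrintedFacts → PotMultBranchIMC → GordTwoBranchIMC → AnticycControlAdditive → StepLManinLink →
HeegnerTwistData → JointLowerManin → PartnerUpperRankZero → SchneiderFree.AdditiveX3RankOneLower`.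
Pure bookkeeping, the SAME term as the route's deciding theorem `closes`: destructure the thirteen
printed facts, get STEP L (Manin-robust) from the link, the Heegner/twist data `(N, K, Dt, H, ι, P, Wd)`
from `HeegnerTwistData`, place the pair on the N10 locus
(`Additive.N10.cellM_or_cellGordTwo_of_classX3_of_subSemistableTwist`, `Additive.N10.locus_iff_cells`),
read off `IndexLowerBoundLeAt W p K P (v_p Dt.c)`, feed `JointLowerManin` (joint lower half) and
`PartnerUpperRankZero` (the twist's upper half), and conclude the leaf by
`Typed.missingLowerBoundAt_of_joint_of_upper`. Nothing is asserted: every crux and every printed fact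
stays a hypothesis of the item. HONEST FRAMING: this closes the ASSEMBLY item only (rung K1 leaf
`AdditiveX3RankOneLower` is NOT claimed; BSD is not proved by any of this).

References: Miller, LMS J. Comput. Math. 14 (2011) Def. 1.1 [Miller2011LMS]; Jetchev–Skinner–Wan,
Camb. J. Math. 5 (2017) §7.4.1 [JetchevSkinnerWan2017].
-/

set_option autoImplicit false

namespace Summit.BirchSwinnertonDyer.BirchSwinnertonDyer.Theorems

/-- **Item `Assembly` of route `SchneiderFreeAdditiveX3` holds**: the thirteen printed facts, the three
analytic cruxes, the link, the Heegner/twist data, the Manin-robust Gross–Zagier bookkeeping and the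
partner's upper half imply the rung leaf `SchneiderFree.AdditiveX3RankOneLower` — by the same term as
the route's `closes` (N10 locus placement, `IndexLowerBoundLeAt` at slack `v_p(Dt.c)`,
`Typed.missingLowerBoundAt_of_joint_of_upper`). [cite: Miller2011LMS, Def. 1.1]
[cite: JetchevSkinnerWan2017, §7.4.1 (shape only; nothing asserted)] -/
theorem schneiderFreeAdditiveX3_assembly_proof :
    Summit.BirchSwinnertonDyer.BirchSwinnertonDyer.Theses.SchneiderFreeAdditiveX3.Assembly := by
  intro hF h2 h3 h4 hL hK hJ hU
  obtain ⟨hGZ, hKo, hGZK, hmod, hmodD, hCas, hGZ73, hFH, hpar, hHP, hDel, hW16, hWu⟩ := hF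
  intro W _ _ p _ hr hp2 hX hS
  have hstep :
      Summit.BirchSwinnertonDyer.BirchSwinnertonDyer.Theorems.SchneiderFree.AdditiveStepLInputManinAt W p :=
    hL h2 h3 h4 W p hr hp2 hX hS
  have hdata :
      Summit.BirchSwinnertonDyer.BirchSwinnertonDyer.Theorems.SchneiderFree.HeegnerTwistDataManinAt W p :=
    hK hFH hpar hHP hGZ hmod hmodD W p hr hp2 hX hS
  obtain ⟨N, _, K, _, _, Dt, H, ι, P, Wd, _, _, hN, hKiq, hodd, hunit, hHe, hLtw, hP, hnt, hWd,
    hrd, hXd, hSd⟩ := hdata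
  have hloc : Summit.BirchSwinnertonDyer.Rank1Residual.Additive.N10.Locus W p :=
    (Summit.BirchSwinnertonDyer.Rank1Residual.Additive.N10.locus_iff_cells W p).mpr
      ((Summit.BirchSwinnertonDyer.Rank1Residual.Additive.N10.cellM_or_cellGordTwo_of_classX3_of_subSemistableTwist
          W p hp2 hX hS).elim Or.inl (fun h ↦ Or.inr (Or.inl h)))
  have hidx :
      Summit.BirchSwinnertonDyer.BirchSwinnertonDyer.Theorems.SchneiderFree.IndexLowerBoundLeAt W p K P
        (padicValNat p Dt.c.natAbs) :=
    hstep N K Dt H ι P hr hloc hN hKiq hodd hunit hHe hLtw hP hnt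
  have hJ' : Literature.NumberTheory.EllipticCurves.Rank1Residual.Typed.JointLowerBoundAt W Wd p :=
    hJ hGZ hKo hGZK hmod hmodD hCas hGZ73 W p N K Dt H ι P Wd hr hN hKiq hodd hunit hHe hLtw hP hnt hWd
      hrd hp2 hidx
  exact Literature.NumberTheory.EllipticCurves.Rank1Residual.Typed.missingLowerBoundAt_of_joint_of_upper
    hJ' (hU hDel hGZK hmod hmodD hW16 hWu Wd p hrd hp2 hXd hSd)

end Summit.BirchSwinnertonDyer.BirchSwinnertonDyer.Theorems
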